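import Literature.AlgebraicGeometry.Hu2025.Statements.S01S09Interface.R110fSetupOurs
import Literature.AlgebraicGeometry.Hu2025.Proofs.S01S09Interface.GammaQuadHu22SetupLit
import HarnessLib

/-!
# Hu 2022 p.131 l.40–41, OURS two-step reading (row 110 f, `Hu22Setup_ours`) — the inhabitant `S_quad : Hu22Setup_ours ℚ 9 d_quad`
# with `X = cell` INTEGRAL, image of `cell ↪ Z_{Γ_d}` = the Prop-9.1 locus, and `Z_{Γ_d}` NOT integral
# (joint J1 / GAP-LEDGER-HU row HU-R01 — OURS; nothing of the sources asserted)

**HONEST FRAMING (D-0012/D-0089).** [Hu2025]/[Hu2022] are unrefereed preprints under adjudication; nothing of them is asserted. Row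
110 f (res-type-024, requested by the M-Hu lead 2026-08-27T07:24:58Z) refines the literal record `Hu22Setup` by (i) `range_cellToGamma`
(the open immersion `cell ↪ Z_Γ` has image `{x̄_u ∉ 𝔭 ∀ u ∉ Γ_d}`) and reads the sentence as `Hu22P131L40_ours S := IsIntegral S.X →
IsIntegral S.cell → IsIntegral Z_{Γ_d}`. This file extends the literal inhabitant `Lit.S_quad_lit` of `GammaQuadHu22SetupLit.lean`
(𝔽 = ℚ, n = 9, M = quadHuMatroid, X := cell := the open matroid Schubert cell of the complete quadrilateral, integral) by the field
(i) (`Lit.range_cellToGammaQ`) and records **`¬ Hu22P131L40_ours S_quad`** and **`¬ Hu22P131L40 S_quad.toHu22Setup`**: for this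
occurring `d` the two-step reading fails at the DENSITY step (the cell is not dense in `Z_{Γ_d}`). A statement about OUR typed
records; it bears on the adjudication of the inference, not on the truth of [Hu25] Thm 1.3. AI proof is weaker than expert review.
-/

noncomputable section

namespace Literature.AlgebraicGeometry.Hu2025.Statements.S01S09Interface

open _root_.CategoryTheory _root_.AlgebraicGeometry S03Pluecker S07GammaSchemes S08MainTheorem

/-- **THE INHABITANT of the OURS record**: `S_quad : Hu22Setup_ours ℚ 9 quadHuMatroid` = the literal inhabitant `Lit.S_quad_lit`
(`X := cell`, `r := 0`, `U := ⊤`, `cellToGamma := Spec` of the localisation) with (i) `range_cellToGamma` = the Prop-9.1 locus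
(`Lit.range_cellToGammaQ`). OURS.
[cite: Hu2025, (9.2)/(9.3) and [Hu22] p.131 l.29–41; joint J1 = GAP-LEDGER-HU row HU-R01; M-Hu lead request 2026-08-27T07:24:58Z (unrefereed preprints arXiv:2507.21400v1 / arXiv:2203.03842v4 under adjudication, D-0012/D-0089 — kernel statement about OUR typed records of rows 101/109/110; nothing of the sources asserted)] -/
def S_quad : Hu22Setup_ours ℚ 9 quadHuMatroid where
  toHu22Setup := Lit.S_quad_lit
  range_cellToGamma := Lit.range_cellToGammaQ

/-- **¬ Hu22P131L40_ours S_quad**: `X = cell` is integral (twice) and `Z_{Γ_d}` is not (`Lit.not_isIntegral_gammaSpec_Γq`).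
[cite: Hu2025, [Hu22] p.131 l.40–41 (OURS two-step reading, row 110 f); joint J1 = GAP-LEDGER-HU row HU-R01 (unrefereed preprints under adjudication, D-0012/D-0089 — kernel statement about OUR typed records; nothing of the sources asserted)] -/
theorem not_Hu22P131L40_ours_quad : ¬ Hu22P131L40_ours S_quad := fun h =>
  Lit.not_isIntegral_gammaSpec_Γq
    (h (inferInstanceAs (IsIntegral Lit.cellScheme)) (inferInstanceAs (IsIntegral Lit.cellScheme)))

/-- **¬ Hu22P131L40 S_quad.toHu22Setup** (= `Lit.not_Hu22P131L40_quad_lit`, restated for the extended record by definitional unfolding).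
[cite: Hu2025, [Hu22] p.131 l.40–41 (literal reading, row 110 e); joint J1 = GAP-LEDGER-HU row HU-R01 (unrefereed preprints under adjudication, D-0012/D-0089 — kernel statement about OUR typed records; nothing of the sources asserted)] -/
theorem not_Hu22P131L40_quad : ¬ Hu22P131L40 S_quad.toHu22Setup :=
  Lit.not_Hu22P131L40_quad_lit


/-! ## The failure mode in words: the cell is NOT DENSE in `Z_{Γ_d}` (elementary certificate: `g` with `g · m₄₅₇ ∈ I_{℘,Γ}`, `g(P) = 1`) -/

/-- The involution determinant `g` of the quadrilateral (`GammaQuadNotIntegral.quadInvolutionDet`) as an element of `Z_{Γ_d}`'s ring.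
OURS.
[cite: Hu2025, (9.3) «Gr^{3,E}_d is an open subset of the Γ-scheme Z_Γ» / [Hu22] p.131 l.33–41; joint J1 = GAP-LEDGER-HU row HU-R01 (unrefereed preprints under adjudication, D-0012/D-0089 — kernel statement about OUR typed records of rows 101/109/110; nothing of the sources asserted)] -/
def gΓ : GammaSchemeRing (primaryFamily 9 ℚ) Lit.Γq :=
  Ideal.Quotient.mk _ (basicIncl 9 ℚ (quadInvolutionDet ℚ 9))

/-- `g · x̄_{457} = 0` in the ring of `Z_{Γ_d}` (the certificate `quad_mul_mem`: `m₄₅₇ · g ∈ (Γ-minors)`).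
[cite: Hu2025, (9.3) «Gr^{3,E}_d is an open subset of the Γ-scheme Z_Γ» / [Hu22] p.131 l.33–41; joint J1 = GAP-LEDGER-HU row HU-R01 (unrefereed preprints under adjudication, D-0012/D-0089 — kernel statement about OUR typed records of rows 101/109/110; nothing of the sources asserted)] -/
theorem gΓ_mul_x457 :
    gΓ * Ideal.Quotient.mk (gammaWpIdeal (primaryFamily 9 ℚ) Lit.Γq) (xbar ℚ (4, 5, 7)) = 0 := by
  have h457 : ((4, 5, 7) : ℕ × ℕ × ℕ) ∈ plVarSet 9 := mem_plVarSet (by norm_num) (by norm_num) (by norm_num) (by norm_num) (by norm_num)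
  rw [gΓ, ← map_mul, Ideal.Quotient.eq_zero_iff_mem, Lit.gammaWpIdeal_Γq]
  -- `x̄_457 ≡ basicIncl (chartMinor 457)` modulo `(𝓕_m) ⊆ I`, and `basicIncl (g · m457) ∈ I`
  have h1 : xbar ℚ (4, 5, 7) - basicIncl 9 ℚ (chartMinor ℚ (4, 5, 7)) ∈ gammaChartIdeal ℚ 9 quadGamma := by
    have := sub_incl_chartParam_mem ℚ (xbar ℚ (4, 5, 7) : ChartRing 9 ℚ)
    rw [chartParam_xbar ℚ h457] at this
    exact Ideal.mem_sup_left this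
  have h2 : basicIncl 9 ℚ (quadInvolutionDet ℚ 9) * basicIncl 9 ℚ (chartMinor ℚ (4, 5, 7)) ∈
      gammaChartIdeal ℚ 9 quadGamma := by
    rw [← map_mul, mul_comm]
    exact map_basicIncl_gammaMinorIdeal_le ℚ (quadGamma_subset le_rfl) (Ideal.mem_map_of_mem _ (quad_mul_mem ℚ))
  have : basicIncl 9 ℚ (quadInvolutionDet ℚ 9) * xbar ℚ (4, 5, 7) =
      basicIncl 9 ℚ (quadInvolutionDet ℚ 9) * (xbar ℚ (4, 5, 7) - basicIncl 9 ℚ (chartMinor ℚ (4, 5, 7))) +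
        basicIncl 9 ℚ (quadInvolutionDet ℚ 9) * basicIncl 9 ℚ (chartMinor ℚ (4, 5, 7)) := by ring
  rw [this]
  exact Ideal.add_mem _ (Ideal.mul_mem_left _ _ h1) h2

/-- `g · (∏_{u ∉ Γ} x̄_u) = 0` in the ring of `Z_{Γ_d}`.
[cite: Hu2025, (9.3) «Gr^{3,E}_d is an open subset of the Γ-scheme Z_Γ» / [Hu22] p.131 l.33–41; joint J1 = GAP-LEDGER-HU row HU-R01 (unrefereed preprints under adjudication, D-0012/D-0089 — kernel statement about OUR typed records of rows 101/109/110; nothing of the sources asserted)] -/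
theorem gΓ_mul_den : gΓ * Lit.denΓq = 0 := by
  have h457 : ((4, 5, 7) : ℕ × ℕ × ℕ) ∈ QuadCell.offGamma := QuadCell.mem_offGamma.1
  rw [Lit.denΓq, QuadCell.hprod, ← Finset.mul_prod_erase _ _ h457, map_mul, ← mul_assoc, gΓ_mul_x457, zero_mul]

/-- **The coplanar point `P`** (all of `a₄,…,a₉` on the line `x_{12j} = 0`) as a `ℚ`-point of `Z_{Γ_d}`: a ring map killing `I_{℘,Γ_d}`
with `g(P) = 1`. OURS.
[cite: Hu2025, (9.3) «Gr^{3,E}_d is an open subset of the Γ-scheme Z_Γ» / [Hu22] p.131 l.33–41; joint J1 = GAP-LEDGER-HU row HU-R01 (unrefereed preprints under adjudication, D-0012/D-0089 — kernel statement about OUR typed records of rows 101/109/110; nothing of the sources asserted)] -/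
def φP : GammaSchemeRing (primaryFamily 9 ℚ) Lit.Γq →+* ℚ :=
  Ideal.Quotient.lift _ ((evalAt ℚ 9 quadPointP).comp (chartParam 9 ℚ).toRingHom) (by
    intro F hF
    rw [Lit.gammaWpIdeal_Γq, mem_gammaChartIdeal_iff ℚ (quadGamma_subset le_rfl)] at hF
    have hle : gammaMinorIdeal ℚ 9 quadGamma ≤ RingHom.ker (evalAt ℚ 9 quadPointP) := by
      unfold gammaMinorIdeal
      rw [Ideal.span_le]
      rintro _ ⟨u, hu, rfl⟩
      rw [SetLike.mem_coe, RingHom.mem_ker]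
      exact evalP_gamma ℚ le_rfl u hu
    have := hle hF
    rw [RingHom.mem_ker] at this
    rw [RingHom.comp_apply, AlgHom.toRingHom_eq_coe, RingHom.coe_coe]
    exact this)

/-- `g(P) = 1`.
[cite: Hu2025, (9.3) / [Hu22] p.131 l.33–41; joint J1 = GAP-LEDGER-HU row HU-R01 (unrefereed preprints under adjudication, D-0012/D-0089 — kernel statement about OUR typed records; nothing of the sources asserted)] -/
theorem φP_gΓ : φP gΓ = 1 := by
  rw [φP, gΓ, Ideal.Quotient.lift_mk, RingHom.comp_apply, AlgHom.toRingHom_eq_coe, RingHom.coe_coe, chartParam_basicIncl]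
  exact evalP_g ℚ le_rfl

/-- **The point `P` of `Z_{Γ_d}`** (the prime `ker φP`). OURS.
[cite: Hu2025, (9.3) «Gr^{3,E}_d is an open subset of the Γ-scheme Z_Γ» / [Hu22] p.131 l.33–41; joint J1 = GAP-LEDGER-HU row HU-R01 (unrefereed preprints under adjudication, D-0012/D-0089 — kernel statement about OUR typed records of rows 101/109/110; nothing of the sources asserted)] -/
def ptP : PrimeSpectrum (GammaSchemeRing (primaryFamily 9 ℚ) Lit.Γq) :=
  ⟨RingHom.ker φP, RingHom.ker_isPrime _⟩

/-- The image of the cell is the basic open set of `∏_{u ∉ Γ} x̄_u`.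
[cite: Hu2025, (9.3) / [Hu22] p.131 l.33–41; joint J1 = GAP-LEDGER-HU row HU-R01 (unrefereed preprints under adjudication, D-0012/D-0089 — kernel statement about OUR typed records; nothing of the sources asserted)] -/
theorem range_cell_eq_basicOpen :
    (Set.range Lit.cellToGammaQ.base : Set (PrimeSpectrum (GammaSchemeRing (primaryFamily 9 ℚ) Lit.Γq))) =
      ((PrimeSpectrum.basicOpen Lit.denΓq : TopologicalSpace.Opens (PrimeSpectrum (GammaSchemeRing (primaryFamily 9 ℚ) Lit.Γq))) :
        Set (PrimeSpectrum (GammaSchemeRing (primaryFamily 9 ℚ) Lit.Γq))) := by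
  rw [Lit.cellToGammaQ, Spec.map_base]
  exact PrimeSpectrum.localization_away_comap_range Lit.CellRing Lit.denΓq

/-- **THE CELL IS NOT DENSE IN `Z_{Γ_d}`**: the image of the open immersion `S_quad.cellToGamma` (= the matroid Schubert cell of the
complete quadrilateral inside the chart) misses the non-empty open set `{g ≠ 0}` ∋ `P`. This is the failure mode of the two-step
reading [Hu22] p.131 l.40–41 for this occurring `d`, in words.
[cite: Hu2025, (9.3) «Gr^{3,E}_d is an open subset of the Γ-scheme Z_Γ» / [Hu22] p.131 l.33–41; joint J1 = GAP-LEDGER-HU row HU-R01 (unrefereed preprints under adjudication, D-0012/D-0089 — kernel statement about OUR typed records of rows 101/109/110; nothing of the sources asserted)] -/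
theorem not_dense_range_cellToGamma : ¬ Dense (Set.range S_quad.cellToGamma.base) := by
  intro hd
  -- work in `PrimeSpectrum` of the ring of `Z_{Γ_d}` (the carrier of `gammaSpec` is that spectrum)
  have hd' : Dense (Set.range Lit.cellToGammaQ.base : Set (PrimeSpectrum (GammaSchemeRing (primaryFamily 9 ℚ) Lit.Γq))) := hd
  rw [range_cell_eq_basicOpen] at hd'
  have hP : ptP ∈ ((PrimeSpectrum.basicOpen gΓ : TopologicalSpace.Opens _) : Set (PrimeSpectrum _)) := by
    rw [SetLike.mem_coe, PrimeSpectrum.mem_basicOpen]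
    show gΓ ∉ RingHom.ker φP
    rw [RingHom.mem_ker, φP_gΓ]
    exact one_ne_zero
  obtain ⟨x, hxU, hxs⟩ := hd'.inter_open_nonempty _ (PrimeSpectrum.isOpen_basicOpen (a := gΓ)) ⟨ptP, hP⟩
  rw [SetLike.mem_coe, PrimeSpectrum.mem_basicOpen] at hxU hxs
  have h0 : gΓ * Lit.denΓq ∈ x.asIdeal := by rw [gΓ_mul_den]; exact Ideal.zero_mem _
  rcases x.isPrime.mem_or_mem h0 with h | h
  · exact hxU h
  · exact hxs h

end Literature.AlgebraicGeometry.Hu2025.Statements.S01S09Interface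

end
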